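/-
Copyright: the b2b-balaban cell (near-miss cell 7), T⁴-continuum fan-out; row NE7b ROUND-2 swarm, seat
t4-ne7b-formalise-leaf-04 (gen 2) — row S4c (iii) ∕ S7 of `t4/b2b-balaban-t4-ne7b-p1/LEAVES-NE7b.md`, companion of
`Support/HistorySocketTHLE`.  Released under the licence of the surrounding project.
-/
import Summits.QuantumFields.BalabanUV.T4Continuum.Support.HistorySocketTHLE

/-!
# The LE history socket along Bałaban's tuned runs

Summits-side support leaf of the T⁴-continuum cell (rung (B)+1 on a FINITE torus only; NOT infinite volume, NOT the
mass gap, NOT the Clay statement; NOT a proof of the spine estimate NE7b).  Row NE7b, route «COUNT», ROUND-2 swarm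
claim table `t4/b2b-balaban-t4-ne7b-p1/LEAVES-NE7b.md`, row S4c (iii) ∕ S7, seat `t4-ne7b-formalise-leaf-04` gen 2.
Companion of `Support/HistorySocketTHLE` (the socket v3 sibling with `consistent` over `ConsistentTLE`, ENDs over
leaf-02's `HistoryExitLE.relWeightBound_canon_of_irThresholdLE`), kept apart for the 400-line budget — exactly as
`HistorySocketTHTuned` accompanies `HistorySocketTH`.  [folklore] composition BY NAME; nothing is quoted from print,
nothing printed is asserted, no `[cite:]` tag, no `Prop`-valued fact is minted (trigger c1).

WHAT.  **`relWeightBound_of_liveHistoriesTHLE_tuned`**, **`hybridNE7_of_liveHistoriesTHLE_tuned`**: the LE socket's ENDs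
along the TUNED runs `g K := (D.C ⟨K, F.m, g₀ K⟩).flow.g` — the flow binders `h27 h29 hx1 hir` REPLACED by box
β-bounds (⇐ `BetaPertHyp`, displayed BY NAME via S8 `HistoryFlow.flowBinders_of_tuned`), `γ ≤ γ₀`, `γ²β′ < 1`,
`SmallnessFor γ β′ β₀ F.L p` (`p ≥ C.p₀, rr`), tuning `D.Tuned γ g g₀`, and the infrared smallness of the RENORMALISED
coupling at leaf-02's SHAPE-FREE threshold `irThresholdTLE C F.L rr β₀ ≤ log g⁻²` (`HistoryFlow.hir_of_tuned`); `hR`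
((2.5) side condition) and `hP` (`0 ≤ p₀(g_{K,s})`) stay displayed, as in `HistorySocketTHTuned`.  (The clamped-credits
lemma under `ConsistentTLE` the assembly needs is already `HistoryAssemblyTreesLE.credits_clampLE`, leaf-03 p210307.)

HONEST: NE7b NOT proved; spine 0∕9.  HONEST DEPENDENCY (cell): continuum YM on T⁴ ⇐ BetaPertH ∧ nine spine estimates
(0/9 proved); BetaPertH ⇐ (D1) ∧ (D4) ∧ CAP+tail.  This file changes none of it.
-/

open Finset
open Literature.MathematicalPhysics.QuantumFieldTheory.Balaban1983to89
open T4PersistenceDictionary T4PersistentHistoryCount T4BankedInduction T4PrintedShapeBanking T4WeightBudget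
open T4GlobalDenominator T4LiveClassFibration T4LiveStructureGas T4LiveGasToTerms T4RecordPriceSeam T4IndicatorShell
open T4MatchingAssembly T4MatchingClosure T4MatchingClosureSocket T4PartnerMultiplicity T4Continuum
open T4BranchingRecordsGas T4TaggedShapeBanking T4CanonicalMenus T4CountHorizon
open Summit.QuantumFields.BalabanUV.T4Continuum.CountThresholdUniform
open Summit.QuantumFields.BalabanUV.T4Continuum.CountThresholdExit
open Summit.QuantumFields.BalabanUV.T4Continuum.CountSeamJunction
open Summit.QuantumFields.BalabanUV.T4Continuum.LateMergers
open Summit.QuantumFields.BalabanUV.T4Continuum.HistoryFlow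
open Summit.QuantumFields.BalabanUV.T4Continuum.HistorySocketTH
open Summit.QuantumFields.BalabanUV.T4Continuum.HistoryExitLE
open Summit.QuantumFields.BalabanUV.T4Continuum.HistorySocketTHLE

namespace Summit.QuantumFields.BalabanUV.T4Continuum.HistorySocketTHLETuned

noncomputable section

/-! ## §1 Along Bałaban's tuned runs -/

section Tuned

variable {F : T4Family} {G : Type*} [GaugeGroup G] [MeasurableSpace G] [HaarData G]
variable {ε γc κ ι : Type*} [DecidableEq ε] [DecidableEq γc] [DecidableEq κ] [DecidableEq ι] {l₀ vol : ℝ} {K₀ : ℕ}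
  {π : ℕ → ι → κ} {T : ℕ → Finset ι} {A A' shA shB : ℕ → ℝ → ι → ℝ} {Bad' : ℕ → ℝ → Finset κ}
  {dead dead' : ℕ → ℝ → ι → ℝ} {Fc Rf Fc' Rf' : ℕ → κ → ℝ} {nlow nup mlow mup : ℕ → ℝ → ℝ} {Cn : ℝ}
  {Cc Rr CcRec RrRec : ℕ → ℝ → ι → ℝ} {ν u s₂ c₀ r s Wsh : ℕ → ℝ}

omit [DecidableEq ι] in
/-- **THE TREE-COUNT EXIT OVER THE LE SOCKET ALONG THE TUNED RUNS** `g K := (D.C ⟨K, F.m, g₀ K⟩).flow.g`: the flow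
binders `h27 h29 hx1 hir` REPLACED by box β-bounds (⇐ `BetaPertHyp`, `HistoryFlow` §3), `γ ≤ γ₀`, `γ²β′ < 1`,
`SmallnessFor γ β′ β₀ F.L p` (`p ≥ C.p₀, rr`), tuning, and the infrared smallness of the RENORMALISED coupling at the
shape-free threshold `irThresholdTLE C F.L rr β₀ ≤ log g⁻²`; `hR` ((2.5) side condition) and `hP` (`0 ≤ p₀(g_{K,s})`)
stay displayed. [folklore] -/
theorem relWeightBound_of_liveHistoriesTHLE_tuned (Dd : FiniteEpsData F G) (sh : ε → PEv)
    {C : T4PrintedShapeBanking.Consts} {rr : ℕ} {β₀ : ℝ} (h : ThresholdOK C F.L rr β₀) (hμ₀ : 0 < C.μ)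
    {γ₀ γ b β' gc : ℝ} {p : ℕ} (hb : 0 ≤ b) (hlo : FlowStep.BetaLowerH b γ₀ Dd.βfun)
    (hhi : FlowStep.BetaUpperH β' γ₀ Dd.βfun) (hγ : γ ≤ γ₀) (hγβ : γ ^ 2 * β' < 1)
    (S : B14FlowStep.SmallnessFor γ β' β₀ F.L p) (hp₀ : C.p₀ ≤ p) (hrr : rr ≤ p)
    {g₀ : ℕ → ℝ} (ht : Dd.Tuned γ gc g₀)
    (Cell : ℕ → ℕ → Finset γc) {V Λ : ℝ} (hV : 0 ≤ V) (hΛ : 0 < Λ)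
    (hcell : ∀ K a, ((Cell K a).card : ℝ) ≤ V * Λ ^ a) (Dcap Ncap : ℕ → ℕ)
    (jstar : ℕ → ℕ) (hj : ∀ K, jstar K ≤ K) {c : ℝ} (hc : 0 < c)
    (hfrac : ∀ K : ℕ, c * K ≤ ((K - jstar K : ℕ) : ℝ)) {Δ : ℝ} (hΔ : 1 ≤ Δ)
    (hir : irThresholdTLE C F.L rr β₀ ≤ Real.log (gc ^ 2)⁻¹)
    (hA : Regeneration l₀ π T A Bad' dead Fc Rf nlow nup Cn K₀)
    (hA' : Regeneration l₀ π T A' Bad' dead' Fc' Rf' mlow mup Cn K₀) (hCn : 0 ≤ Cn)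
    (R : ℕ → ℕ → ℕ) (hR : ∀ K s, s ≤ K → B14.IsRj F.L rr ((Dd.C ⟨K, F.m, g₀ K⟩).flow.g s) (R K s))
    (hP : ∀ K s, 0 ≤ p0Profile C.A₀ C.p₀ ((Dd.C ⟨K, F.m, g₀ K⟩).flow.g s))
    {ηplus : ℝ} (hηplus : 0 ≤ ηplus) (hr : Λ * Real.exp (ηplus - C.κ₁) < 1)
    {Λ' : ℝ} (hΛ0 : 0 ≤ Λ') (h1 : Λ' * Real.exp (-C.κ₁) * Real.exp ηplus < 1)
    (hx : (Real.exp (-C.E₀) + Real.exp (-C.E₀) * birthMass C *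
          (Λ' * Real.exp (-C.κ₁) / (1 - Λ' * Real.exp (-C.κ₁) * Real.exp ηplus))) * Real.exp ηplus ≤
        Real.exp ηplus - 1)
    {live : ℕ → κ → Finset (γc × Gen ε)}
    (H : LiveHistoriesTHLE sh C Λ' Δ l₀ K₀ R (fun K => (Dd.C ⟨K, F.m, g₀ K⟩).flow.g) Cell Dcap Ncap jstar Bad' Fc Rf
      Fc' Rf' live) :
    ∃ K₁, K₀ ≤ K₁ ∧ RelWeightBound l₀ T A A' (fun K t => if K₁ ≤ K then badOfClass π T Bad' K t else ∅)
      (Set.indicator {K | K₁ ≤ K} (fun K => Cn * recordsBudget (Δ * birthMass C) C.κ₁ V Λ ηplus jstar K)) := by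
  obtain ⟨h27, h29, hx1, -⟩ := flowBinders_of_tuned Dd hb hlo hhi hγ hγβ S hp₀ hrr ht R hR
  exact relWeightBound_of_liveHistoriesTHLE sh h hμ₀ Cell hV hΛ hcell Dcap Ncap jstar hj hc hfrac hΔ hA hA' hCn R
    (fun K => (Dd.C ⟨K, F.m, g₀ K⟩).flow.g) (fun _ => β') (fun K _ => h27 K) (fun K _ => h29 K)
    (fun K _ s hs => hR K s hs) (fun K _ s hs => hx1 K s hs) (fun K _ => hir_of_tuned Dd ht hir K) hP hηplus hr hΛ0
    h1 hx H

/-- **… AND INTO THE SEAM, ALONG THE TUNED RUNS.** [folklore] -/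
theorem hybridNE7_of_liveHistoriesTHLE_tuned (Dd : FiniteEpsData F G) (sh : ε → PEv)
    {C : T4PrintedShapeBanking.Consts} {rr : ℕ} {β₀ : ℝ} (h : ThresholdOK C F.L rr β₀) (hμ₀ : 0 < C.μ)
    {γ₀ γ b β' gc : ℝ} {p : ℕ} (hb : 0 ≤ b) (hlo : FlowStep.BetaLowerH b γ₀ Dd.βfun)
    (hhi : FlowStep.BetaUpperH β' γ₀ Dd.βfun) (hγ : γ ≤ γ₀) (hγβ : γ ^ 2 * β' < 1)
    (S : B14FlowStep.SmallnessFor γ β' β₀ F.L p) (hp₀ : C.p₀ ≤ p) (hrr : rr ≤ p)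
    {g₀ : ℕ → ℝ} (ht : Dd.Tuned γ gc g₀)
    (Cell : ℕ → ℕ → Finset γc) {V Λ : ℝ} (hV : 0 ≤ V) (hΛ : 0 < Λ)
    (hcell : ∀ K a, ((Cell K a).card : ℝ) ≤ V * Λ ^ a) (Dcap Ncap : ℕ → ℕ)
    (jstar : ℕ → ℕ) (hj : ∀ K, jstar K ≤ K) {c : ℝ} (hc : 0 < c)
    (hfrac : ∀ K : ℕ, c * K ≤ ((K - jstar K : ℕ) : ℝ)) {Δ : ℝ} (hΔ : 1 ≤ Δ)
    (hir : irThresholdTLE C F.L rr β₀ ≤ Real.log (gc ^ 2)⁻¹)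
    (hA : Regeneration l₀ π T A Bad' dead Fc Rf nlow nup Cn K₀)
    (hA' : Regeneration l₀ π T A' Bad' dead' Fc' Rf' mlow mup Cn K₀) (hCn : 0 ≤ Cn)
    (R : ℕ → ℕ → ℕ) (hR : ∀ K s, s ≤ K → B14.IsRj F.L rr ((Dd.C ⟨K, F.m, g₀ K⟩).flow.g s) (R K s))
    (hP : ∀ K s, 0 ≤ p0Profile C.A₀ C.p₀ ((Dd.C ⟨K, F.m, g₀ K⟩).flow.g s))
    {ηplus : ℝ} (hηplus : 0 ≤ ηplus) (hr : Λ * Real.exp (ηplus - C.κ₁) < 1)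
    {Λ' : ℝ} (hΛ0 : 0 ≤ Λ') (h1 : Λ' * Real.exp (-C.κ₁) * Real.exp ηplus < 1)
    (hx : (Real.exp (-C.E₀) + Real.exp (-C.E₀) * birthMass C *
          (Λ' * Real.exp (-C.κ₁) / (1 - Λ' * Real.exp (-C.κ₁) * Real.exp ηplus))) * Real.exp ηplus ≤
        Real.exp ηplus - 1)
    {live : ℕ → κ → Finset (γc × Gen ε)}
    (H : LiveHistoriesTHLE sh C Λ' Δ l₀ K₀ R (fun K => (Dd.C ⟨K, F.m, g₀ K⟩).flow.g) Cell Dcap Ncap jstar Bad' Fc Rf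
      Fc' Rf' live)
    (hSh : ShellWeightBound l₀ T A A' shA shB Wsh)
    (hTB : ReindexedBudget l₀ vol T (fun K t τ => A K t τ - shA K t τ) (fun K t τ => A' K t τ - shB K t τ)
      (badOfClass π T Bad') Cc Rr CcRec RrRec ν u s₂ c₀ r s)
    (hrs : Summable r) (hu : Summable u) (hs : Summable s) (hs₂ : Summable s₂) :
    ∃ K₁ K₂, K₀ ≤ K₁ ∧ HybridNE7 l₀ vol (fun K => T (K₁ + (K₂ + K))) (fun K => A (K₁ + (K₂ + K)))
      (fun K => A' (K₁ + (K₂ + K))) (fun K => badOfClass π T Bad' (K₁ + (K₂ + K)))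
      (fun K => Cn * recordsBudget (Δ * birthMass C) C.κ₁ V Λ ηplus jstar (K₁ + (K₂ + K)))
      (fun K => shA (K₁ + (K₂ + K))) (fun K => shB (K₁ + (K₂ + K))) (fun K => Wsh (K₁ + (K₂ + K)))
      (fun K => (r (K₁ + (K₂ + K)) + u (K₁ + (K₂ + K))) + (s (K₁ + (K₂ + K)) + s₂ (K₁ + (K₂ + K)))) :=
  hybridNE7_of_eventually
    (relWeightBound_of_liveHistoriesTHLE_tuned Dd sh h hμ₀ hb hlo hhi hγ hγβ S hp₀ hrr ht Cell hV hΛ hcell Dcap Ncap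
      jstar hj hc hfrac hΔ hir hA hA' hCn R hR hP hηplus hr hΛ0 h1 hx H)
    hSh hTB hrs hu hs hs₂

end Tuned

end

end Summit.QuantumFields.BalabanUV.T4Continuum.HistorySocketTHLETuned
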